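/-
Copyright (c) 2026 the pub-hodgecm-mathlib formalisation cell (harness21).  Prover seat hodgecm-mathlib-K2E3-p26 (g2), Track B «K2-LIT» (valve hand → L1),
#184♮ = hLiu418 = `stmt-HodgeConjecture-24832`; socket #41, KIND W, brick (KW-fac) (LEAD F0P6-plan (g14) BATCH #156 (2) ∕ #163 (1) ∕ #165 (1); KW desk F0P2-p08 (g3)):
THE `fT ∕ hfac` LETTERS OF THE KIND-W TOP AND THE Σ⊗ STRUCTURE OF `fT` WITH ONE `m` FOR ALL `T ⊇ S₀` (the `hsum` input of ★ `hPart_of_letters`).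
THEOREMS ONLY (no `def`, no `instance`, no notation, no named-fact hypothesis, no `sorry`); lane `--supports stmt-HodgeConjecture-24832` (count-neutral helper; closes no socket by itself).
-/
import Summits.HodgeConjecture.HodgeConjecture.Theorems.K2LiuStdFamilyAwayPurityFlat     -- ★ (E6′) `exists_awayPurity_flat` (slice identity for every `s`, letters of `A, b` at `s₀`); brings `modDelta`, `placesEmbed`, `LambdaLoc`
import Summits.HodgeConjecture.HodgeConjecture.Theorems.K2LiuStdSectionAwayPurity        -- brings ★ #31s `stdFamilyFactorisable` (+ prelims `archPart_placesEmbed`, `evalPlace_finPart_placesEmbed_of_mem∕_of_not_mem`), ★ Φ3a `exists_finset_level_of_isStandardSectionFamily`, ★ (S4-good) `eventually_forall_exists_siegelDelta_mul_localInt`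
import HarnessLib

/-!
# Crux `HLiu418`, socket #41, KIND W, brick (KW-fac) — `K2LiuKindWFactorizableDecomposition`: A STANDARD SECTION FAMILY IS FACTORIZABLE OFF EVERY `T ⊇ S₀` THROUGH ITS
# OWN SLICES `fT_s(y_∞, y) := f_s(placesEmbed_T(y_∞, y))`, AND EVERY SLICE IS ONE FINITE SUM OF PURE TENSORS `Σ_{i<m} F^∞_i(s, y_∞) · ∏_{v∈T} F_{i,v}(s, y_v)` WITH THE
# SAME `m` FOR ALL `T` — the extra places `v ∈ T ∖ S₀` carry the spherical section `Λ_{s,v}`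

Cell `hodgecm-mathlib`, crux item hLiu418 = `stmt-HodgeConjecture-24832` (helper lane `--supports … --as helper`, count-neutral), route of record `HCCMUnconditional`;
squad K2 ∕ K2Liu (L1, LEAD F0P6-plan (g14)), road `K2_Liu`, socket #41 `sig_K2LiuSiegelEisensteinContinuation`, KIND W; author K2E3-p26 (g2); KW desk F0P2-p08 (g3).
CONSUMERS: ★ `kindW_block_of_record` ∕ K2E4-p11 (g9) (ii)′ `kindW_block_cm_of_letters` — binders `{fT} (hfac : ∀ T ⊇ T₀, IsFactorizableOff T μ̃ f (fT T))`; ★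
`K2LiuSiegelEisensteinKindWPartOfLetters.hPart_of_letters` — binder `hsum : fT (kindWFinset T₀ S h) s (a, x) = Σ_j FinfT j S h s a · ∏_{v : kindWFinset …} FvT j S h v s (x v)` with ONE
`{m}` bound before `(S, h)`; (iii-fin) K2E3-p29 (`FvT`), (iii-arch) LH4-p08∕p10 (`FinfT`).
EVERYTHING MATHEMATICAL IS ★; this file is the assembly:
(a) `hfac` = ★ #31s `stdFamilyFactorisable` with its four by-value guards discharged as in ★ (asm-3AB) `K2LiuStdSectionAwayPurity` §3 (★ Φ3a `exists_finset_level_of_isStandardSectionFamily`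
for `K^T_H ⊆ 𝒦.K` and right-invariance at `s₀`; ★ (S4-good) `eventually_forall_exists_siegelDelta_mul_localInt`; ★ `eventually_forall_placesOver` + `isUnramifiedAt_cofinite_holds`);
(b) the Σ⊗ structure of the slices = ★ (E6′) `K2LiuStdFamilyAwayPurityFlat.exists_awayPurity_flat` at `T := S₀` (slice identity for EVERY `s`, five letters of `A, b` at `s₀`);
(c) ONE `m` FOR ALL `T ⊇ S₀`: §1 pushes the slice at `S₀` to any `T ⊇ S₀` through (a) — `f_s(placesEmbed_T(y_∞, y)) = f_s(placesEmbed_{S₀}(y_∞, y|_{S₀})) · ∏_{v ∈ T ∖ S₀} Λ_{s,v}(y_v)`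
(the `T`-point has components `y_v` on `T`, `1` off `T`, and `Λ_{s,v}(1) = 1` ★ `lambdaLoc_one`; Mathlib `finprod_eq_prod_of_mulSupport_subset`), so the extra places carry the
spherical factor and NO new pure terms appear; §0 is the Finset bookkeeping `(∏_{v:S₀} P) · ∏_{v:T} [v ∈ S₀ ? 1 : Q] = ∏_{v:T} [v ∈ S₀ ? P : Q]`.
* §0 `prod_mul_prod_ite_eq`.
* §1 **`apply_placesEmbed_eq_mul_prod_lambdaLoc`** — the push (c).
* §2 **`exists_kindW_factorization`** — `∃ S₀`: `χ` unramified off `S₀` (the TOP's `hχ`), `∀ T ⊇ S₀, IsFactorizableOff T χ f (s x ↦ f s (placesEmbed T x))` (the TOP's `hfac` with `fT` EXPLICIT),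
  and `∃ m b A` with (E6′)'s letters at `s₀` on `S₀` and, for every `T ⊇ S₀`, `s`, `(y_∞, y)`:
  `f s (placesEmbed T (y_∞, y)) = Σ_i (H_∞(y_∞)^{2(s−s₀)}·A_i y_∞) · ∏_{v:T} (v ∈ S₀ ? H_v(y_v)^{2(s−s₀)}·b_{i,v}(y_v) : Λ_{s,v}(y_v))` (`H_∞, H_v` = `modDelta ∘ 𝒦.pPart` of (E6)).
READING for ★ `hPart_of_letters` (any `T₀ ⊇ S₀`, `T := kindWFinset T₀ ↑S h ⊇ S₀`): `fT := fun T s x => f s (placesEmbed T x)`, `FinfT j S h s a := H_∞(a)^{2(s−s₀)}·A j a`,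
`FvT j S h v s y := if v.1 ∈ S₀ then H_v(y)^{2(s−s₀)}·b j v.1 y else Λ_{s,v.1}(y)` — its `hsum` binder token for token, one `m`.
[Tan1999, §1 p. 166]; [KudlaRallis1994, §1]; [HarrisKudlaSweet1996, §1 (1.15)–(1.17)]; [Liu2011, §2B p. 862]; [BorelJacquet1979, §4.1]; [Flath1979, §2].

HONEST LABEL.  Count-neutral helper; it retires nothing by itself: `HC_CM` is proved only modulo the 7 printed citations (2 remaining named inputs:
hLiu418 = `stmt-HodgeConjecture-24832`, h413 = `stmt-HodgeConjecture-24833`) until rung 0 closes.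

## References
* [Tan1999] V. Tan, *Poles of Siegel Eisenstein series on U(n,n)*, Canad. J. Math. 51 (1999), §1 p. 166 (`Φ(g, s) = Φ_v ⊗ Φ^v`, standard sections).
* [KudlaRallis1994] S. Kudla, S. Rallis, *A regularized Siegel–Weil formula: the first term identity*, Ann. of Math. 140 (1994), §1.
* [HarrisKudlaSweet1996] M. Harris, S. Kudla, W. J. Sweet, *Theta dichotomy for unitary groups*, J. AMS 9 (1996), §1 (1.15)–(1.17).
* [Liu2011] Y. Liu, *Arithmetic theta lifting and L-derivatives for unitary groups I*, Algebra & Number Theory 5 (2011), §2B p. 862.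
* [BorelJacquet1979] A. Borel, H. Jacquet, *Automorphic forms and automorphic representations*, Proc. Sympos. Pure Math. 33.1 (1979), §4.1.
* [Flath1979] D. Flath, *Decomposition of representations into tensor products*, Proc. Sympos. Pure Math. 33.1 (1979), §2.
-/

set_option autoImplicit false
-- the mandated namespace repeats the single-problem summit's segment (`HodgeConjecture.HodgeConjecture`)
set_option linter.dupNamespace false

noncomputable section

open scoped Matrix RestrictedProduct
open Filter Topology Set NumberField IsDedekindDomain
open Literature.NumberTheory.Automorphic hiding IsKFinite
open Literature.NumberTheory.Automorphic.UnitaryGroup Literature.NumberTheory.GaloisRepresentations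
open Literature.NumberTheory.GelbartRogawski1991 Literature.NumberTheory.GelbartRogawski1991.GRConstruction
open Literature.NumberTheory.GelbartRogawski1991.UnitaryDualPair Literature.NumberTheory.GelbartRogawski1991.UnitaryDualPair.LocalSplitting
open Literature.NumberTheory.K2Lit.SiegelDoubled Literature.NumberTheory.K2Lit.LocalSiegelDoubled Literature.NumberTheory.K2Lit.PlaceSplitting
open Summit.HodgeConjecture.HodgeConjecture.Cruxes.HLiu418.K2LiuStdFamilyFactorisable
open Summit.HodgeConjecture.HodgeConjecture.Cruxes.HLiu418.K2LiuStdDatumLevelOffS (exists_finset_level_of_isStandardSectionFamily)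
open Summit.HodgeConjecture.HodgeConjecture.Cruxes.HLiu418.K2LiuSWGeneratorGoodPlaces (eventually_forall_exists_siegelDelta_mul_localInt)
open Summit.HodgeConjecture.HodgeConjecture.Cruxes.HLiu418.K2LiuStdFamilyAwayPurityFlat (exists_awayPurity_flat heightTwistLoc_mem_localDegPS)

namespace Summit.HodgeConjecture.HodgeConjecture.Cruxes.HLiu418.K2LiuKindWFactorizableDecomposition

/-! ## §0 Finset bookkeeping -/

/-- `(∏_{v:S₀} P v) · ∏_{v:T} [v ∈ S₀ ? 1 : Q v] = ∏_{v:T} [v ∈ S₀ ? P v : Q v]` for `S₀ ⊆ T` (Mathlib `Finset.prod_ite`, `Finset.prod_bij'`). [folklore] -/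
theorem prod_mul_prod_ite_eq {ι : Type*} [DecidableEq ι] {S₀ T : Finset ι} (hST : S₀ ⊆ T) {R : Type*} [CommMonoid R] (P Q : ↥T → R) :
    (∏ v : ↥S₀, P ⟨v.1, hST v.2⟩) * (∏ v : ↥T, if v.1 ∈ S₀ then (1 : R) else Q v) = ∏ v : ↥T, if v.1 ∈ S₀ then P v else Q v := by
  rw [Finset.prod_ite, Finset.prod_ite, Finset.prod_const_one, one_mul]
  congr 1
  refine Finset.prod_bij' (fun v _ => (⟨v.1, hST v.2⟩ : ↥T)) (fun w hw => (⟨w.1, (Finset.mem_filter.1 hw).2⟩ : ↥S₀)) (fun v _ => Finset.mem_filter.2 ⟨Finset.mem_univ _, v.2⟩)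
    (fun w _ => Finset.mem_univ _) (fun v _ => Subtype.ext rfl) (fun w _ => Subtype.ext rfl) (fun v _ => rfl)

/-! ## §1 Pushing a slice from `S₀` to `T ⊇ S₀`: the extra places carry `Λ_{s,v}` -/

section Push

variable (L : Type) [Field L] [NumberField L] [IsCMField L]
variable {N M n : ℕ} (e : Fin N × Fin M ≃ Fin n)
  (dV : Fin N → L) (hdV : ∀ i, IsCMField.complexConj L (dV i) = dV i)
  (dW : Fin M → L) (hdW : ∀ i, IsCMField.complexConj L (dW i) = dW i)

set_option maxHeartbeats 400000 in -- MEASURED: fails at 300 000 (`whnf` on the adelic telescope under `finprod`∕`Finset.prod`), passes at 400 000; plain `rw`, no search tactics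
/-- **THE PUSH**: if `f` is factorizable off `S₀` through its own `S₀`-slices and `χ` is unramified off `S₀`, then for `T ⊇ S₀` the `T`-slice is the `S₀`-slice times the spherical
factors at the extra places: `f_s(placesEmbed_T(y_∞, y)) = f_s(placesEmbed_{S₀}(y_∞, y|_{S₀})) · ∏_{v:T} [v ∈ S₀ ? 1 : Λ_{s,v}(y_v)]` (components of the `T`-point: `y_∞`, `y_v` on `T`, `1` off `T`
★ `archPart_placesEmbed` ∕ `evalPlace_finPart_placesEmbed_of_mem∕_of_not_mem`; `Λ_{s,v}(1) = 1` ★ `lambdaLoc_one`; Mathlib `finprod_eq_prod_of_mulSupport_subset`).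
[cite: Tan1999, §1 p. 166] [cite: Liu2011, §2B p. 862] [cite: BorelJacquet1979, §4.1] -/
theorem apply_placesEmbed_eq_mul_prod_lambdaLoc [DecidableEq (HeightOneSpectrum (𝓞 (Fp L)))] {S₀ T : Finset (HeightOneSpectrum (𝓞 (Fp L)))} (hST : S₀ ⊆ T)
    {χ : HeckeCharacter L} {f : ℂ → HA L e dV hdV dW hdW → ℂ}
    (hfac : IsFactorizableOff L e dV hdV dW hdW S₀ χ f (fun s x => f s (placesEmbed L (hermD L e dV hdV dW hdW) S₀ x)))
    (hχ : ∀ v, v ∉ S₀ → ∀ w : UnitaryGroup.PlacesOver L v, χ.IsUnramifiedAt w.1) (s : ℂ)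
    (yi : UnitaryGroup.arch (Fp L) L (IsCMField.complexConj L) (n + n) (hermD L e dV hdV dW hdW))
    (y : Π v : ↥T, UnitaryGroup.localPi L (IsCMField.complexConj L) (n + n) (hermD L e dV hdV dW hdW) v.1) :
    f s (placesEmbed L (hermD L e dV hdV dW hdW) T (yi, y)) =
      f s (placesEmbed L (hermD L e dV hdV dW hdW) S₀ (yi, fun v : ↥S₀ => y ⟨v.1, hST v.2⟩)) *
        ∏ v : ↥T, (if v.1 ∈ S₀ then (1 : ℂ) else
          LambdaLoc L e dV hdV dW hdW v.1 χ s (y v)) := by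
  have hA := hfac s (placesEmbed L (hermD L e dV hdV dW hdW) T (yi, y))
  beta_reduce at hA
  have hcomp : (fun v : ↥S₀ => UnitaryGroup.evalPlace (Fp L) L (IsCMField.complexConj L) (n + n) (hermD L e dV hdV dW hdW) v.1
      (UnitaryGroup.finPart (Fp L) L (IsCMField.complexConj L) (n + n) (hermD L e dV hdV dW hdW) (placesEmbed L (hermD L e dV hdV dW hdW) T (yi, y)))) =
      fun v : ↥S₀ => y ⟨v.1, hST v.2⟩ :=
    funext fun v => evalPlace_finPart_placesEmbed_of_mem L e dV hdV dW hdW T yi y v.1 (hST v.2)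
  rw [hA, archPart_placesEmbed, hcomp]
  congr 1
  -- the off-`S₀` product: `Λ_{s,v}(y_v)` on `T ∖ S₀`, `1` off `T`
  set F : HeightOneSpectrum (𝓞 (Fp L)) → ℂ := fun v => LambdaLoc L e dV hdV dW hdW v χ s
    (UnitaryGroup.evalPlace (Fp L) L (IsCMField.complexConj L) (n + n) (hermD L e dV hdV dW hdW) v
      (UnitaryGroup.finPart (Fp L) L (IsCMField.complexConj L) (n + n) (hermD L e dV hdV dW hdW) (placesEmbed L (hermD L e dV hdV dW hdW) T (yi, y)))) with hF
  have hF1 : ∀ v, v ∉ T → F v = 1 := fun v hv => by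
    rw [hF]
    beta_reduce
    rw [evalPlace_finPart_placesEmbed_of_not_mem L e dV hdV dW hdW T yi y v hv, lambdaLoc_one L e dV hdV dW hdW v χ s (hχ v fun h => hv (hST h))]
  -- the off-`S₀` product is a finite product over the places of `T` outside `S₀`
  have hsupp : Function.mulSupport (fun v : {v : HeightOneSpectrum (𝓞 (Fp L)) // v ∉ S₀} => F v.1) ⊆
      ↑(T.subtype fun v : HeightOneSpectrum (𝓞 (Fp L)) => v ∉ S₀) := fun v hv => by
    rw [Finset.mem_coe, Finset.mem_subtype]
    by_contra h
    exact hv (hF1 v.1 h)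
  rw [show (∏ᶠ v : {v : HeightOneSpectrum (𝓞 (Fp L)) // v ∉ S₀}, LambdaLoc L e dV hdV dW hdW v.1 χ s
      (UnitaryGroup.evalPlace (Fp L) L (IsCMField.complexConj L) (n + n) (hermD L e dV hdV dW hdW) v.1
        (UnitaryGroup.finPart (Fp L) L (IsCMField.complexConj L) (n + n) (hermD L e dV hdV dW hdW) (placesEmbed L (hermD L e dV hdV dW hdW) T (yi, y))))) =
      ∏ᶠ v : {v : HeightOneSpectrum (𝓞 (Fp L)) // v ∉ S₀}, F v.1 from rfl,
    finprod_eq_prod_of_mulSupport_subset _ hsupp, Finset.prod_ite, Finset.prod_const_one, one_mul]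
  refine Finset.prod_bij' (fun v hv => (⟨v.1, Finset.mem_subtype.1 hv⟩ : ↥T)) (fun w hw => (⟨w.1, (Finset.mem_filter.1 hw).2⟩ : {v : HeightOneSpectrum (𝓞 (Fp L)) // v ∉ S₀}))
    (fun v _ => Finset.mem_filter.2 ⟨Finset.mem_univ _, v.2⟩) (fun w _ => Finset.mem_subtype.2 w.2) (fun v _ => Subtype.ext rfl) (fun w _ => Subtype.ext rfl)
    (fun v hv => ?_)
  rw [hF]
  beta_reduce
  rw [evalPlace_finPart_placesEmbed_of_mem L e dV hdV dW hdW T yi y v.1 (Finset.mem_subtype.1 hv)]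

end Push

/-! ## §2 The factorization letters of a standard family, one `m` for all `T ⊇ S₀` -/

section Main

variable (L : Type) [Field L] [NumberField L] [IsCMField L]
variable {N M n : ℕ} (e : Fin N × Fin M ≃ Fin n)
  (dV : Fin N → L) (hdV : ∀ i, IsCMField.complexConj L (dV i) = dV i) (hdV0 : ∀ i, dV i ≠ 0)
  (dW : Fin M → L) (hdW : ∀ i, IsCMField.complexConj L (dW i) = dW i) (hdW0 : ∀ i, dW i ≠ 0)

set_option maxHeartbeats 400000 in -- MEASURED: fails at the default 200 000 (`whnf` on ★ #31s's 40-binder telescope + ★ (E6′)'s ∃-block), passes at 400 000; plain `obtain`∕`exact`, no search tactics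
include hdV0 hdW0 in
/-- **(KW-fac) THE FACTORIZATION LETTERS OF A STANDARD SECTION FAMILY.**  For a STANDARD Iwasawa datum `𝒦`, a `𝒦`-standard family `f` for `χ` with every `f s` continuous, and a base
parameter `s₀`, there is a finite set `S₀` of places of `L⁺` such that:
(1) `χ` is unramified above every `v ∉ S₀` (the TOP's `hχ`);
(2) for every `T ⊇ S₀`, `f` IS FACTORIZABLE OFF `T` THROUGH ITS OWN SLICES: `IsFactorizableOff T χ f (s x ↦ f s (placesEmbed T x))` — the TOP's `hfac` with `fT T s x := f s (placesEmbed T x)`;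
(3) there are `m`, local factors `b i v : H_v → ℂ` and archimedean factors `A i : H_∞ → ℂ` with ★ (E6′)'s letters at `s₀` on `S₀` — `b i v ∈ I_v(s₀, χ_v)` (★ `localDegPS`) for `v ∈ S₀`,
and the flat twist `u ↦ H_v(u)^{2(s−s₀)}·b i v u ∈ I_v(s, χ_v)` for EVERY `s` (★ `heightTwistLoc_mem_localDegPS`; the per-factor letter the (iii-fin-int) consumer asked for),
`A i` `K_∞`-finite, continuous, an archimedean Siegel section of weight `(χ, s₀)` — such that FOR EVERY `T ⊇ S₀`, every `s` and every `(y_∞, y) ∈ H_∞ × ∏_{v∈T} H_v`: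
`f s (placesEmbed T (y_∞, y)) = Σ_i (H_∞(y_∞)^{2(s−s₀)}·A i y_∞) · ∏_{v:T} [v ∈ S₀ ? H_v(y_v)^{2(s−s₀)}·b i v (y_v) : Λ_{s,v}(y_v)]`, `H = modDelta ∘ 𝒦.pPart` — ONE `m` for all `T`.
[cite: Tan1999, §1 p. 166] [cite: KudlaRallis1994, §1] [cite: HarrisKudlaSweet1996, §1 (1.15)–(1.17)] [cite: Liu2011, §2B p. 862] [cite: BorelJacquet1979, §4.1] [cite: Flath1979, §2] -/
theorem exists_kindW_factorization [DecidableEq (HeightOneSpectrum (𝓞 (Fp L)))] {𝒦 : IwasawaDatum L e dV hdV dW hdW} (h𝒦 : 𝒦.IsStd)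
    {χ : HeckeCharacter L} {f : ℂ → HA L e dV hdV dW hdW → ℂ} (hf : IsStandardSectionFamily 𝒦 χ f) (hfc : ∀ s, Continuous (f s)) (s₀ : ℂ) :
    ∃ S₀ : Finset (HeightOneSpectrum (𝓞 (Fp L))),
      (∀ v, v ∉ S₀ → ∀ w : UnitaryGroup.PlacesOver L v, χ.IsUnramifiedAt w.1) ∧
      (∀ T : Finset (HeightOneSpectrum (𝓞 (Fp L))), S₀ ⊆ T →
        IsFactorizableOff L e dV hdV dW hdW T χ f (fun s x => f s (placesEmbed L (hermD L e dV hdV dW hdW) T x))) ∧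
      ∃ (m : ℕ) (b : Fin m → (v : HeightOneSpectrum (𝓞 (Fp L))) → (UnitaryGroup.localPi L (IsCMField.complexConj L) (n + n) (hermD L e dV hdV dW hdW) v → ℂ))
        (A : Fin m → UnitaryGroup.arch (Fp L) L (IsCMField.complexConj L) (n + n) (hermD L e dV hdV dW hdW) → ℂ),
        (∀ i, ∀ v ∈ S₀, b i v ∈ localDegPS (Fp L) L (IsCMField.complexConj L) (complexConj_imagUnit L) (imagUnit_ne_zero L) (imagUnit_mul_self L)
          v n (gramR_isSymm L e dV hdV dW hdW) (hermD_eq_map_gramD L e dV hdV dW hdW) (fun w => χ.localComponent w.1) s₀) ∧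
        -- the per-factor letter of the `S₀`-factors AT EVERY `s` (★ (E6′) `heightTwistLoc_mem_localDegPS`: the flat twist is a smooth local Siegel section of weight `(χ_v, s)`)
        (∀ i, ∀ v ∈ S₀, ∀ s : ℂ, (fun u => ((modDelta L e dV hdV dW hdW (𝒦.pPart (locToAdelic L e dV hdV dW hdW v u)) : ℝ) : ℂ) ^ (2 * (s - s₀)) * b i v u) ∈
          localDegPS (Fp L) L (IsCMField.complexConj L) (complexConj_imagUnit L) (imagUnit_ne_zero L) (imagUnit_mul_self L)
            v n (gramR_isSymm L e dV hdV dW hdW) (hermD_eq_map_gramD L e dV hdV dW hdW) (fun w => χ.localComponent w.1) s) ∧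
        (∀ i, (∃ V : Submodule ℂ (UnitaryGroup.arch (Fp L) L (IsCMField.complexConj L) (n + n) (hermD L e dV hdV dW hdW) → ℂ), FiniteDimensional ℂ V ∧ A i ∈ V ∧
          ∀ a₀ : UnitaryGroup.arch (Fp L) L (IsCMField.complexConj L) (n + n) (hermD L e dV hdV dW hdW),
            (UnitaryGroup.archToAdelic (Fp L) L (IsCMField.complexConj L) (n + n) (hermD L e dV hdV dW hdW) a₀ : HA L e dV hdV dW hdW) ∈ 𝒦.K → ∀ G ∈ V, (fun x => G (x * a₀)) ∈ V)) ∧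
        (∀ i, Continuous (A i)) ∧
        (∀ i, (∀ p : HA L e dV hdV dW hdW, IsSiegelDelta L e dV hdV dW hdW p → UnitaryGroup.finPart (Fp L) L (IsCMField.complexConj L) (n + n) (hermD L e dV hdV dW hdW) p = 1 →
          ∀ x : UnitaryGroup.arch (Fp L) L (IsCMField.complexConj L) (n + n) (hermD L e dV hdV dW hdW),
            A i (UnitaryGroup.archPart (Fp L) L (IsCMField.complexConj L) (n + n) (hermD L e dV hdV dW hdW) p * x) = siegelDeltaCharacter L e dV hdV dW hdW χ s₀ p * A i x)) ∧
        ∀ T : Finset (HeightOneSpectrum (𝓞 (Fp L))), S₀ ⊆ T →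
          ∀ (s : ℂ) (yi : UnitaryGroup.arch (Fp L) L (IsCMField.complexConj L) (n + n) (hermD L e dV hdV dW hdW))
            (y : Π v : ↥T, UnitaryGroup.localPi L (IsCMField.complexConj L) (n + n) (hermD L e dV hdV dW hdW) v.1),
            f s (placesEmbed L (hermD L e dV hdV dW hdW) T (yi, y)) =
              ∑ i, (((modDelta L e dV hdV dW hdW (𝒦.pPart (UnitaryGroup.archToAdelic (Fp L) L (IsCMField.complexConj L) (n + n) (hermD L e dV hdV dW hdW) yi)) : ℝ) : ℂ) ^ (2 * (s - s₀)) * A i yi) *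
                ∏ v : ↥T, (if v.1 ∈ S₀
                  then ((modDelta L e dV hdV dW hdW (𝒦.pPart (locToAdelic L e dV hdV dW hdW v.1 (y v))) : ℝ) : ℂ) ^ (2 * (s - s₀)) * b i v.1 (y v) else
                  LambdaLoc L e dV hdV dW hdW v.1 χ s (y v)) := by
  haveI : Algebra.IsQuadraticExtension (Fp L) L := IsCMField.isQuadraticExtension L
  -- (a) the three cofinite guards of ★ #31s: level (★ Φ3a), `χ` unramified, local Iwasawa (★ (S4-good))
  obtain ⟨S₁, hS₁⟩ := exists_finset_level_of_isStandardSectionFamily L e dV hdV dW hdW h𝒦 hf hfc s₀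
  obtain ⟨T₂, hT₂⟩ : ∃ T₂ : Finset (HeightOneSpectrum (𝓞 (Fp L))), ∀ v ∉ T₂, ∀ w : UnitaryGroup.PlacesOver L v, χ.IsUnramifiedAt w.1 :=
    ⟨(Filter.eventually_cofinite.1 (UnitaryGroup.eventually_forall_placesOver (F := Fp L) L (Q := fun w => χ.IsUnramifiedAt w)
        (HeckeCharacter.isUnramifiedAt_cofinite_holds χ))).toFinset,
      fun v hv => by
        by_contra h1
        exact hv ((Set.Finite.mem_toFinset _).2 h1)⟩
  obtain ⟨T₃, hT₃⟩ : ∃ T₃ : Finset (HeightOneSpectrum (𝓞 (Fp L))), ∀ v ∉ T₃, ∀ x : UnitaryGroup.localPi L (IsCMField.complexConj L) (n + n) (hermD L e dV hdV dW hdW) v,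
      ∃ p ∈ siegelDeltaLoc L e dV hdV dW hdW v, ∃ k ∈ UnitaryGroup.localInt L (IsCMField.complexConj L) (n + n) (hermD L e dV hdV dW hdW) v, x = p * k :=
    ⟨(Filter.eventually_cofinite.1 (eventually_forall_exists_siegelDelta_mul_localInt L e dV hdV hdV0 dW hdW hdW0)).toFinset, fun v hv => by
      by_contra h1
      exact hv ((Set.Finite.mem_toFinset _).2 h1)⟩
  -- (b) ★ (E6′)
  obtain ⟨S₄, hS₄⟩ := exists_awayPurity_flat L e dV hdV hdV0 dW hdW hdW0 h𝒦 hf hfc s₀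
  -- the set of record
  refine ⟨S₁ ∪ T₂ ∪ T₃ ∪ S₄, ?_⟩
  have hχ₀ : ∀ v, v ∉ S₁ ∪ T₂ ∪ T₃ ∪ S₄ → ∀ w : UnitaryGroup.PlacesOver L v, χ.IsUnramifiedAt w.1 :=
    fun v hv => hT₂ v fun h => hv (Finset.mem_union_left _ (Finset.mem_union_left _ (Finset.mem_union_right _ h)))
  have hfacT : ∀ T : Finset (HeightOneSpectrum (𝓞 (Fp L))), S₁ ∪ T₂ ∪ T₃ ∪ S₄ ⊆ T →
      IsFactorizableOff L e dV hdV dW hdW T χ f (fun s x => f s (placesEmbed L (hermD L e dV hdV dW hdW) T x)) := by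
    intro T hT
    have hS₁T : S₁ ⊆ T := ((Finset.subset_union_left.trans Finset.subset_union_left).trans Finset.subset_union_left).trans hT
    have hχT : ∀ v, v ∉ T → ∀ w : UnitaryGroup.PlacesOver L v, χ.IsUnramifiedAt w.1 := fun v hv => hχ₀ v fun h => hv (hT h)
    have hIwT : ∀ v, v ∉ T → ∀ x : UnitaryGroup.localPi L (IsCMField.complexConj L) (n + n) (hermD L e dV hdV dW hdW) v,
        ∃ p ∈ siegelDeltaLoc L e dV hdV dW hdW v, ∃ k ∈ UnitaryGroup.localInt L (IsCMField.complexConj L) (n + n) (hermD L e dV hdV dW hdW) v, x = p * k :=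
      fun v hv => hT₃ v fun h => hv (hT (Finset.mem_union_left _ (Finset.mem_union_right _ h)))
    exact (stdFamilyFactorisable L e dV hdV hdV0 dW hdW hdW0 T χ hχT hIwT 𝒦 f hf (hS₁ T hS₁T).1 s₀ (hS₁ T hS₁T).2).2
  obtain ⟨-, -, m, b, A, hb, hfin, hcont, hsieg, -, hslice⟩ := hS₄ (S₁ ∪ T₂ ∪ T₃ ∪ S₄) Finset.subset_union_right
  refine ⟨hχ₀, hfacT, m, b, A, hb, fun i v hv s => heightTwistLoc_mem_localDegPS L e dV hdV hdV0 dW hdW hdW0 v h𝒦 (hb i v hv) s, hfin, hcont, hsieg,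
    fun T hT s yi y => ?_⟩
  rw [apply_placesEmbed_eq_mul_prod_lambdaLoc L e dV hdV dW hdW hT (hfacT _ (Finset.Subset.refl _)) hχ₀ s yi y, hslice s yi (fun v => y ⟨v.1, hT v.2⟩), Finset.sum_mul]
  refine Finset.sum_congr rfl fun i _ => ?_
  rw [mul_assoc]
  congr 1
  exact prod_mul_prod_ite_eq hT
    (fun v : ↥T => ((modDelta L e dV hdV dW hdW (𝒦.pPart (locToAdelic L e dV hdV dW hdW v.1 (y v))) : ℝ) : ℂ) ^ (2 * (s - s₀)) * b i v.1 (y v))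
    (fun v : ↥T => LambdaLoc L e dV hdV dW hdW v.1 χ s (y v))

end Main

end Summit.HodgeConjecture.HodgeConjecture.Cruxes.HLiu418.K2LiuKindWFactorizableDecomposition

end
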